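import Literature.AlgebraicGeometry.FundamentalGroup.ProjectiveLineLattices
import Literature.AlgebraicGeometry.FundamentalGroup.ProjectiveLineCharts
import Literature.AlgebraicGeometry.FundamentalGroup.IdempotentSections
import Literature.AlgebraicGeometry.FundamentalGroup.ProjectiveSpaceProofs
import Literature.RingTheory.Etale.FiniteEtaleTraceDual
import Literature.AlgebraicGeometry.Resolution.ReducedOfSmoothOverReduced
import Literature.AlgebraicGeometry.Resolution.ProjectiveSpaceRegular
import Literature.AlgebraicGeometry.Motives.VarietiesProperProofs
import Mathlib.AlgebraicGeometry.Morphisms.IsIso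
import Mathlib.AlgebraicGeometry.Noetherian
import HarnessLib

/-!
# `ℙ¹_k` is simply connected: discharge of `ProjectiveLineSimplyConnected`

Topic: `Literature/AlgebraicGeometry/FundamentalGroup`. This file gives a SECOND, independent
proof of the named fact `ProjectiveLineSimplyConnected` of `ProjectiveSpace.lean` — SGA 1, Exp. XI,
Prop. 1.1 in the case `r = 1`: for `k` algebraically closed, every finite étale `π : Y → ℙ¹_k`
with `Y` connected is an isomorphism (`projectiveLineSimplyConnected_of_traceDuality`; the
discharge `ProjectiveLineSimplyConnected_holds` in `ProjectiveLineSimplyConnectedHolds.lean`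
follows the printed Riemann–Hurwitz route) — by lattice/trace duality instead of curve theory,
assembling

* the lattice criterion `LaurentLattice.card_le_one_of_idempotent` (`ProjectiveLineLattices.lean`:
  a residue–trace duality count replacing Grothendieck's splitting theorem and Riemann–Roch in the
  proof of Görtz–Wedhorn II, Thm. 20.114),
* the étale input `Literature.RingTheory.Etale.*` (`FiniteEtaleTraceDual.lean`: a finite étale
  algebra over `k[t]` is free with unit discriminant — Görtz–Wedhorn II Prop. 20.71 (2) — hence
  self-dual for the trace form, also after localising to `k[t, t⁻¹]`),
* the charts of `ℙ¹` (`ProjectiveLineCharts.lean`: `Γ(D₊(x₀)) = k[t]`, `Γ(D₊(x₁)) = k[t⁻¹]`,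
  `Γ(D₊(x₀x₁)) = k[t, t⁻¹]` with its Laurent basis, and `D₊(x₀x₁) = D(t)`),
* connectedness ⇒ trivial idempotents (`IdempotentSections.lean`).

## The proof (`isIso_of_isFinite_of_etale_proj_of_traceDuality`)

With `U₀ = D₊(x₀)`, `U₁ = D₊(x₁)`, `B₀ = Γ(π⁻¹U₀)`, `B₁ = Γ(π⁻¹U₁)`, `N = Γ(π⁻¹U₀ ∩ π⁻¹U₁)`:
`π` finite étale makes `A₀ = (k[x]_{x₀})₀ → B₀` finite étale (Mathlib `IsFinite.finite_app`,
`HasRingHomProperty.appLE` for `@Etale`), hence `B₀` free (étale ⇒ flat ⇒ torsion-free ⇒ free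
over the PID `k[t]`: Mathlib `Module.free_of_finite_type_torsion_free'`) with a trace-dual
basis (`isUnit_discr_of_formallyEtale`); `N` is the localisation `B₀[1/t] = B₁[1/s]` (Mathlib
`IsAffineOpen.isLocalization_of_eq_basicOpen`, as `π⁻¹ D₊(x₀x₁)` is the basic open of `π^* t`),
so the localised bases and the dictionary "image of `Bᵢ` = coordinates in `k[t]` resp. `k[t⁻¹]`"
(`mem_range_iff_repr`, `range_res₀/₁`) put us in the setting of the lattice criterion. Its
remaining hypotheses: idempotents of `B₀ ∩ B₁ ⊆ N` come from idempotents of `B₀`, `B₁` agreeing on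
the overlap (the localisation maps are injective: `t ≠ 0` acts injectively on the free `B₀`),
hence are `0` or `1` (`Y` is connected, and reduced by
`Resolution.isReduced_of_smooth_of_isReduced_base`); `N ≠ 0` as `π` is surjective; each `bᵢ`
lies in `B₁[1/s]` (`IsLocalization.surj`). The criterion gives rank `1`, so `Aᵢ → Bᵢ` is
bijective (`bijective_algebraMap_of_basis_card_eq_one`), `π.app Uᵢ` is an isomorphism, and `π`
is an isomorphism by the affine-local characterisation of isomorphisms (Mathlib
`HasAffineProperty (isomorphisms Scheme)`, `iff_of_iSup_eq_top`).

No definitions, no named facts; trust base = Mathlib's axioms.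

## Sources

* A. Grothendieck, M. Raynaud, SGA 1, Exp. XI Prop. 1.1. [SGA1]
* U. Görtz, T. Wedhorn, *Algebraic Geometry II* (2023), Thm. 20.114, Prop. 20.71, Cor. 26.70.
  [GortzWedhorn2023]
-/

noncomputable section

namespace Literature.AlgebraicGeometry.FundamentalGroup

/-! ## The main theorem -/

section Main

open CategoryTheory _root_.AlgebraicGeometry TopologicalSpace Opposite MvPolynomial
  HomogeneousLocalization LaurentLattice
open Literature.AlgebraicGeometry.Motives (projectiveSpace)
open Literature.AlgebraicGeometry.Motives.ProjectiveSpace (X_mem)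
open Literature.RingTheory.Etale

universe u

variable (k : Type u) [Field k] [IsAlgClosed k]

attribute [local instance] MvPolynomial.gradedAlgebra
  Literature.AlgebraicGeometry.Motives.ProjBaseChange.algebraBase

/-- A free algebra of rank one is the base: if `B` has an `A`-basis indexed by a one-element type
then `A → B` is bijective (`1 = a v`, `v² = c v` force `a c = 1`). [folklore] -/
theorem bijective_algebraMap_of_basis_card_eq_one {A B : Type*} [CommRing A] [CommRing B]
    [Algebra A B] {ι : Type*} [Fintype ι] (b : Module.Basis ι A B) (hι : Fintype.card ι = 1) :
    Function.Bijective (algebraMap A B) := by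
  obtain ⟨i₀, hi₀⟩ := Fintype.card_eq_one_iff.mp hι
  haveI : Unique ι := ⟨⟨i₀⟩, hi₀⟩
  set v := b i₀ with hv
  set a := b.repr 1 i₀ with ha
  have h1 : (1 : B) = a • v := by
    conv_lhs => rw [← b.sum_repr 1]
    rw [Fintype.sum_unique, hi₀ default]
  set c := b.repr (v * v) i₀ with hc
  have hvv : v * v = c • v := by
    conv_lhs => rw [← b.sum_repr (v * v)]
    rw [Fintype.sum_unique, hi₀ default]
  have hac : a * c = 1 := by
    have : v = (a * c) • v := by
      conv_lhs => rw [← one_mul v, h1, smul_mul_assoc, hvv, smul_smul]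
    have := congrArg (fun x => b.repr x i₀) this
    rw [map_smul, Finsupp.smul_apply, smul_eq_mul, hv, b.repr_self, Finsupp.single_eq_same,
      mul_one] at this
    exact this.symm
  have hau : IsUnit a := isUnit_iff_exists_inv.mpr ⟨c, hac⟩
  constructor
  · intro r s hrs
    have : (r * a) • v = (s * a) • v := by
      rw [← smul_smul, ← smul_smul, ← h1, Algebra.smul_def, Algebra.smul_def, mul_one, mul_one]
      exact hrs
    have := congrArg (fun x => b.repr x i₀) this
    simp only [map_smul, Finsupp.smul_apply, smul_eq_mul, hv, b.repr_self, Finsupp.single_eq_same,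
      mul_one] at this
    exact hau.mul_right_cancel this
  · intro x
    refine ⟨b.repr x i₀ * c, ?_⟩
    rw [Algebra.algebraMap_eq_smul_one, h1, smul_smul, mul_assoc, mul_comm c a, hac, mul_one]
    conv_rhs => rw [← b.sum_repr x]
    rw [Fintype.sum_unique, hi₀ default]

/-- `IsIso (f.app W)` is invariant under equality of opens. [folklore] -/
theorem isIso_app_of_eq {X Y : Scheme.{u}} (f : X ⟶ Y) {W W' : Y.Opens} (h : W = W')
    (hW : IsIso (f.app W)) : IsIso (f.app W') := by
  subst h; exact hW

/-- A bijective morphism of `CommRingCat` is an isomorphism. [folklore] -/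
theorem isIso_of_bijective_hom {R S : CommRingCat.{u}} (f : R ⟶ S)
    (hf : Function.Bijective f.hom) : IsIso f := by
  let e := RingEquiv.ofBijective f.hom hf
  exact ⟨⟨CommRingCat.ofHom e.symm.toRingHom,
    by ext x; exact e.symm_apply_apply x, by ext x; exact e.apply_symm_apply x⟩⟩

set_option maxHeartbeats 800000 in
/-- **`ℙ¹_k` is simply connected** (SGA 1 XI 1.1, `r = 1`; Görtz–Wedhorn II Thm. 20.114 for
`k = k̄`): a finite étale `π : Y → Proj k[x₀,x₁]` with `Y` connected is an isomorphism. Proof: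
over the charts `U₀ = D₊(x₀)`, `U₁ = D₊(x₁)` the cover is given by finite étale, hence free
self-dual, algebras `B₀/k[t]`, `B₁/k[t⁻¹]` glued over `k[t,t⁻¹]`; connectedness makes the
idempotents of `Γ(Y, 𝒪) = B₀ ∩ B₁` trivial, so the lattice criterion
(`LaurentLattice.card_le_one_of_idempotent`) gives rank `1`, i.e. `π` is an isomorphism over
each chart. [cite: SGA1, Exp. XI Prop. 1.1] -/
theorem isIso_of_isFinite_of_etale_proj_of_traceDuality (Y : Scheme.{u})
    (π : Y ⟶ Proj (MvPolynomial.homogeneousSubmodule (Fin 2) k)) [IsFinite π] [Etale π]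
    [ConnectedSpace Y] : IsIso π := by
  classical
  -- notation for the graded ring and the charts
  let 𝒜 := MvPolynomial.homogeneousSubmodule (Fin 2) k
  let P : Scheme.{u} := Proj 𝒜
  let A₀ := Away 𝒜 (X 0 : MvPolynomial (Fin 2) k)
  let A₁ := Away 𝒜 (X 1 : MvPolynomial (Fin 2) k)
  let Λ := Away 𝒜 (X 0 * X 1 : MvPolynomial (Fin 2) k)
  have hx0 : (X 0 : MvPolynomial (Fin 2) k) ∈ 𝒜 1 := X_mem 0
  have hx1 : (X 1 : MvPolynomial (Fin 2) k) ∈ 𝒜 1 := X_mem 1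
  -- the opens
  let U₀ : P.Opens := Proj.basicOpen 𝒜 (X 0)
  let U₁ : P.Opens := Proj.basicOpen 𝒜 (X 1)
  let U₀₁ : P.Opens := Proj.basicOpen 𝒜 (X 0 * X 1)
  have hU₀₁ : U₀₁ = U₀ ⊓ U₁ := Proj.basicOpen_mul ..
  have hU₀ : IsAffineOpen U₀ := Proj.isAffineOpen_basicOpen 𝒜 _ hx0 one_pos
  have hU₁ : IsAffineOpen U₁ := Proj.isAffineOpen_basicOpen 𝒜 _ hx1 one_pos
  have hcovP : U₀ ⊔ U₁ = ⊤ := by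
    have := Proj.iSup_basicOpen_eq_top 𝒜 (fun i : Fin 2 => (X i : MvPolynomial (Fin 2) k))
      (Literature.AlgebraicGeometry.Motives.Segre.irrelevant_le_span_X (Fin 2) k)
    rw [eq_top_iff, ← this]
    exact iSup_le fun i => by fin_cases i <;> [exact le_sup_left; exact le_sup_right]
  let V₀ : Y.Opens := π ⁻¹ᵁ U₀
  let V₁ : Y.Opens := π ⁻¹ᵁ U₁
  have hV : V₀ ⊓ V₁ = π ⁻¹ᵁ U₀₁ := by rw [hU₀₁]; rfl
  have hV₀ : IsAffineOpen V₀ := hU₀.preimage π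
  have hV₁ : IsAffineOpen V₁ := hU₁.preimage π
  have hcovY : V₀ ⊔ V₁ = ⊤ := by
    change π ⁻¹ᵁ (U₀ ⊔ U₁) = ⊤
    rw [hcovP]; rfl
  have hVle : V₀ ⊓ V₁ ≤ π ⁻¹ᵁ U₀₁ := hV.le
  -- the rings of the cover
  let B₀ : Type u := Γ(Y, V₀)
  let B₁ : Type u := Γ(Y, V₁)
  let N : Type u := Γ(Y, V₀ ⊓ V₁)
  -- the ring maps
  let a₀ : A₀ →+* B₀ := (π.app U₀).hom.comp (Proj.awayToSection 𝒜 (X 0)).hom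
  let a₁ : A₁ →+* B₁ := (π.app U₁).hom.comp (Proj.awayToSection 𝒜 (X 1)).hom
  let aΛ : Λ →+* N := (π.appLE U₀₁ (V₀ ⊓ V₁) hVle).hom.comp (Proj.awayToSection 𝒜 (X 0 * X 1)).hom
  let r₀ : B₀ →+* N := (Y.presheaf.map (homOfLE inf_le_left : V₀ ⊓ V₁ ⟶ V₀).op).hom
  let r₁ : B₁ →+* N := (Y.presheaf.map (homOfLE inf_le_right : V₀ ⊓ V₁ ⟶ V₁).op).hom
  -- the two commutative squares
  have sq₀ : ∀ x, r₀ (a₀ x) = aΛ (P1Charts.res₀ k x) := by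
    intro x
    change (Proj.awayToSection 𝒜 (X 0) ≫ π.app U₀ ≫
        Y.presheaf.map (homOfLE inf_le_left : V₀ ⊓ V₁ ⟶ V₀).op) x =
      (CommRingCat.ofHom (P1Charts.res₀ k) ≫ Proj.awayToSection 𝒜 (X 0 * X 1) ≫
        π.appLE U₀₁ (V₀ ⊓ V₁) hVle) x
    congr 1
    rw [P1Charts.res₀, Proj.awayMap_awayToSection_assoc 𝒜 hx1 (P1Charts.hx₀ k),
      Scheme.Hom.map_appLE, Scheme.Hom.app_eq_appLE, Scheme.Hom.appLE_map]
  have sq₁ : ∀ x, r₁ (a₁ x) = aΛ (P1Charts.res₁ k x) := by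
    intro x
    change (Proj.awayToSection 𝒜 (X 1) ≫ π.app U₁ ≫
        Y.presheaf.map (homOfLE inf_le_right : V₀ ⊓ V₁ ⟶ V₁).op) x =
      (CommRingCat.ofHom (P1Charts.res₁ k) ≫ Proj.awayToSection 𝒜 (X 0 * X 1) ≫
        π.appLE U₀₁ (V₀ ⊓ V₁) hVle) x
    congr 1
    rw [P1Charts.res₁, Proj.awayMap_awayToSection_assoc 𝒜 hx0 (P1Charts.hx₁ k),
      Scheme.Hom.map_appLE, Scheme.Hom.app_eq_appLE, Scheme.Hom.appLE_map]
  -- algebra structures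
  letI i₁ : Algebra A₀ B₀ := a₀.toAlgebra
  letI i₂ : Algebra A₁ B₁ := a₁.toAlgebra
  letI i₃ : Algebra Λ N := aΛ.toAlgebra
  letI i₄ : Algebra A₀ Λ := (P1Charts.res₀ k).toAlgebra
  letI i₅ : Algebra A₁ Λ := (P1Charts.res₁ k).toAlgebra
  letI i₆ : Algebra B₀ N := r₀.toAlgebra
  letI i₇ : Algebra B₁ N := r₁.toAlgebra
  letI i₈ : Algebra A₀ N := (aΛ.comp (P1Charts.res₀ k)).toAlgebra
  letI i₉ : Algebra A₁ N := (aΛ.comp (P1Charts.res₁ k)).toAlgebra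
  haveI t₁ : IsScalarTower A₀ Λ N := IsScalarTower.of_algebraMap_eq (fun _ => rfl)
  haveI t₂ : IsScalarTower A₁ Λ N := IsScalarTower.of_algebraMap_eq (fun _ => rfl)
  haveI t₃ : IsScalarTower A₀ B₀ N := IsScalarTower.of_algebraMap_eq (fun x => (sq₀ x).symm)
  haveI t₄ : IsScalarTower A₁ B₁ N := IsScalarTower.of_algebraMap_eq (fun x => (sq₁ x).symm)
  letI i₁₀ : Algebra k N := (aΛ.comp (algebraMap k Λ)).toAlgebra
  haveI t₅ : IsScalarTower k Λ N :=
    IsScalarTower.of_algebraMap_eq (R := k) (S := Λ) (A := N) (fun _ => rfl)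
  -- localisations: `Λ = A₀[1/t] = A₁[1/s]`
  haveI loc₀ : IsLocalization.Away (P1Charts.tgen k) Λ := P1Charts.isLocalization₀ k
  haveI loc₁ : IsLocalization.Away (P1Charts.sgen k) Λ := P1Charts.isLocalization₁ k
  -- `N = B₀[1/t] = B₁[1/s]`: the overlap is the basic open of the section `t`
  let t₀ : Γ(P, U₀) := Proj.awayToSection 𝒜 (X 0) (P1Charts.tgen k)
  let s₁ : Γ(P, U₁) := Proj.awayToSection 𝒜 (X 1) (P1Charts.sgen k)
  have hU₀₁t : U₀₁ = P.basicOpen t₀ := by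
    have := Proj.basicOpen_mul_eq_basicOpen_awayToSection 𝒜 hx0 hx1 one_pos one_pos
    rw [P1Charts.isLocalizationElem_eq_tgen] at this
    exact this
  have hU₀₁s : U₀₁ = P.basicOpen s₁ := by
    have := Proj.basicOpen_mul_eq_basicOpen_awayToSection 𝒜 hx1 hx0 one_pos one_pos
    rw [P1Charts.isLocalizationElem_eq_sgen, ← P1Charts.hx₁] at this
    exact this
  have hVt : V₀ ⊓ V₁ = Y.basicOpen (π.app U₀ t₀) := by
    rw [hV, hU₀₁t, Scheme.preimage_basicOpen]
  have hVs : V₀ ⊓ V₁ = Y.basicOpen (π.app U₁ s₁) := by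
    rw [hV, hU₀₁s, Scheme.preimage_basicOpen]
  have locN₀' : IsLocalization.Away (a₀ (P1Charts.tgen k)) N :=
    hV₀.isLocalization_of_eq_basicOpen (π.app U₀ t₀) (homOfLE inf_le_left) hVt
  have locN₁' : IsLocalization.Away (a₁ (P1Charts.sgen k)) N :=
    hV₁.isLocalization_of_eq_basicOpen (π.app U₁ s₁) (homOfLE inf_le_right) hVs
  haveI locN₀ : IsLocalization (Algebra.algebraMapSubmonoid B₀ (Submonoid.powers (P1Charts.tgen k))) N := by
    rw [Algebra.algebraMapSubmonoid, Submonoid.map_powers]; exact locN₀'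
  haveI locN₁ : IsLocalization (Algebra.algebraMapSubmonoid B₁ (Submonoid.powers (P1Charts.sgen k))) N := by
    rw [Algebra.algebraMapSubmonoid, Submonoid.map_powers]; exact locN₁'
  -- the chart algebras are finite étale, hence free with unit discriminant
  have hfin₀ : a₀.Finite :=
    RingHom.finite_respectsIso.2 (π.app U₀).hom
      (Proj.basicOpenIsoAway 𝒜 (X 0) hx0 one_pos).commRingCatIsoToRingEquiv (π.finite_app U₀ hU₀)
  have hfin₁ : a₁.Finite :=
    RingHom.finite_respectsIso.2 (π.app U₁).hom
      (Proj.basicOpenIsoAway 𝒜 (X 1) hx1 one_pos).commRingCatIsoToRingEquiv (π.finite_app U₁ hU₁)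
  haveI fin₀ : Module.Finite A₀ B₀ := hfin₀
  haveI fin₁ : Module.Finite A₁ B₁ := hfin₁
  have het₀' : RingHom.Etale (π.app U₀).hom := by
    have := HasRingHomProperty.appLE @Etale (f := π) inferInstance ⟨U₀, hU₀⟩ ⟨π ⁻¹ᵁ U₀, hV₀⟩ le_rfl
    change RingHom.Etale (π.appLE U₀ (π ⁻¹ᵁ U₀) le_rfl).hom at this
    rwa [Scheme.Hom.appLE_eq_app] at this
  have het₁' : RingHom.Etale (π.app U₁).hom := by
    have := HasRingHomProperty.appLE @Etale (f := π) inferInstance ⟨U₁, hU₁⟩ ⟨π ⁻¹ᵁ U₁, hV₁⟩ le_rfl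
    change RingHom.Etale (π.appLE U₁ (π ⁻¹ᵁ U₁) le_rfl).hom at this
    rwa [Scheme.Hom.appLE_eq_app] at this
  have het₀ : a₀.Etale :=
    RingHom.Etale.respectsIso.2 (π.app U₀).hom
      (Proj.basicOpenIsoAway 𝒜 (X 0) hx0 one_pos).commRingCatIsoToRingEquiv het₀'
  have het₁ : a₁.Etale :=
    RingHom.Etale.respectsIso.2 (π.app U₁).hom
      (Proj.basicOpenIsoAway 𝒜 (X 1) hx1 one_pos).commRingCatIsoToRingEquiv het₁'
  haveI etale₀ : Algebra.Etale A₀ B₀ := het₀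
  haveI etale₁ : Algebra.Etale A₁ B₁ := het₁
  haveI : IsDomain A₀ := (P1Charts.polyEquiv k 0).symm.toMulEquiv.isDomain (Polynomial k)
  haveI : IsDomain A₁ := (P1Charts.polyEquiv k 1).symm.toMulEquiv.isDomain (Polynomial k)
  haveI : IsPrincipalIdealRing A₀ :=
    IsPrincipalIdealRing.of_surjective (P1Charts.polyEquiv k 0).toRingHom (P1Charts.polyEquiv k 0).surjective
  haveI : IsPrincipalIdealRing A₁ :=
    IsPrincipalIdealRing.of_surjective (P1Charts.polyEquiv k 1).toRingHom (P1Charts.polyEquiv k 1).surjective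
  haveI free₀ : Module.Free A₀ B₀ := Module.free_of_finite_type_torsion_free'
  haveI free₁ : Module.Free A₁ B₁ := Module.free_of_finite_type_torsion_free'
  let b₀ := Module.Free.chooseBasis A₀ B₀
  let b₁ := Module.Free.chooseBasis A₁ B₁
  obtain ⟨bd₀, hbd₀⟩ := exists_traceDual_of_isUnit_discr b₀ (isUnit_discr_of_formallyEtale b₀)
  obtain ⟨bd₁, hbd₁⟩ := exists_traceDual_of_isUnit_discr b₁ (isUnit_discr_of_formallyEtale b₁)
  -- the localised bases of `N` over `Λ`
  let bN₀ := b₀.localizationLocalization Λ (Submonoid.powers (P1Charts.tgen k)) N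
  let bN₁ := b₁.localizationLocalization Λ (Submonoid.powers (P1Charts.sgen k)) N
  -- the Laurent structure and the dictionary ranges ↔ lattices
  have hℓ : IsLaurent (P1Charts.ℓ k) := ⟨P1Charts.ℓ_mul k, P1Charts.ℓ_zero k⟩
  have hdeg₀ : ∀ x : Λ, x ∈ degGE (P1Charts.ℓ k) 0 ↔ x ∈ (algebraMap A₀ Λ).range := by
    intro x
    rw [RingHom.mem_range, ← Set.mem_range, RingHom.algebraMap_toAlgebra, P1Charts.range_res₀]
    rfl
  have hdeg₁ : ∀ x : Λ, x ∈ degLE (P1Charts.ℓ k) 0 ↔ x ∈ (algebraMap A₁ Λ).range := by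
    intro x
    rw [RingHom.mem_range, ← Set.mem_range, RingHom.algebraMap_toAlgebra, P1Charts.range_res₁]
    rfl
  have hB₀ : ∀ x : N, x ∈ coordSub bN₀ (degGE (P1Charts.ℓ k) 0) ↔ x ∈ (algebraMap B₀ N).range := by
    intro x
    rw [mem_coordSub, mem_range_iff_repr (Λ := Λ) (Submonoid.powers (P1Charts.tgen k)) b₀ x]
    exact forall_congr' fun i => hdeg₀ _
  have hB₁ : ∀ x : N, x ∈ coordSub bN₁ (degLE (P1Charts.ℓ k) 0) ↔ x ∈ (algebraMap B₁ N).range := by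
    intro x
    rw [mem_coordSub, mem_range_iff_repr (Λ := Λ) (Submonoid.powers (P1Charts.sgen k)) b₁ x]
    exact forall_congr' fun i => hdeg₁ _
  -- the hypotheses of the lattice criterion
  have Hbd : ∀ i j, Algebra.trace Λ N (algebraMap B₀ N (bd₀ i) * bN₀ j) = if i = j then 1 else 0 :=
    trace_localization_dual (Submonoid.powers (P1Charts.tgen k)) b₀ hbd₀
  have Hdual : ∀ x : N, x ∈ coordSub bN₀ (degGE (P1Charts.ℓ k) 0) ↔
      ∀ y ∈ coordSub bN₀ (degGE (P1Charts.ℓ k) 0), Algebra.trace Λ N (x * y) ∈ degGE (P1Charts.ℓ k) 0 := by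
    intro x
    rw [hB₀, mem_range_iff_trace (Λ := Λ) (Submonoid.powers (P1Charts.tgen k)) b₀ hbd₀ x]
    refine ⟨fun h y hy => (hdeg₀ _).mpr (h y ((hB₀ y).mp hy)),
      fun h y hy => (hdeg₀ _).mp (h y ((hB₀ y).mpr hy))⟩
  have Hdual' : ∀ x : N, x ∈ coordSub bN₁ (degLE (P1Charts.ℓ k) 0) ↔
      ∀ y ∈ coordSub bN₁ (degLE (P1Charts.ℓ k) 0), Algebra.trace Λ N (x * y) ∈ degLE (P1Charts.ℓ k) 0 := by
    intro x
    rw [hB₁, mem_range_iff_trace (Λ := Λ) (Submonoid.powers (P1Charts.sgen k)) b₁ hbd₁ x]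
    refine ⟨fun h y hy => (hdeg₁ _).mpr (h y ((hB₁ y).mp hy)),
      fun h y hy => (hdeg₁ _).mp (h y ((hB₁ y).mpr hy))⟩
  have Hmul : ∀ x ∈ coordSub bN₀ (degGE (P1Charts.ℓ k) 0), ∀ y ∈ coordSub bN₀ (degGE (P1Charts.ℓ k) 0),
      x * y ∈ coordSub bN₀ (degGE (P1Charts.ℓ k) 0) := fun x hx y hy =>
    (hB₀ _).mpr (Subring.mul_mem _ ((hB₀ x).mp hx) ((hB₀ y).mp hy))
  have Hmul' : ∀ x ∈ coordSub bN₁ (degLE (P1Charts.ℓ k) 0), ∀ y ∈ coordSub bN₁ (degLE (P1Charts.ℓ k) 0),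
      x * y ∈ coordSub bN₁ (degLE (P1Charts.ℓ k) 0) := fun x hx y hy =>
    (hB₁ _).mpr (Subring.mul_mem _ ((hB₁ x).mp hx) ((hB₁ y).mp hy))
  have Hone : (1 : N) ∈ coordSub bN₀ (degGE (P1Charts.ℓ k) 0) := (hB₀ 1).mpr (Subring.one_mem _)
  have Hone' : (1 : N) ∈ coordSub bN₁ (degLE (P1Charts.ℓ k) 0) := (hB₁ 1).mpr (Subring.one_mem _)
  -- `Y` is reduced, so `N` is reduced
  haveI : IsIntegral P := Literature.AlgebraicGeometry.Resolution.isIntegral_projectiveSpace 1 k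
  haveI : IsLocallyNoetherian P := by
    have h : IsLocallyNoetherian (projectiveSpace 1 k).left := by
      haveI := Literature.AlgebraicGeometry.Motives.isProper_projectiveSpace 1 k
      exact LocallyOfFiniteType.isLocallyNoetherian (projectiveSpace 1 k).hom
    exact h
  haveI : IsReduced Y :=
    Literature.AlgebraicGeometry.Resolution.isReduced_of_smooth_of_isReduced_base π
  haveI : _root_.IsReduced N := inferInstance
  -- `N ≠ 0`: the overlap is non-empty (π is surjective) and its stalks are local rings
  haveI : Nontrivial N := by
    haveI : Nonempty Y := inferInstance
    haveI hsurj := @surjective_of_isFinite_of_etale_projectiveSpace k _ 1 Y π ‹IsFinite π› ‹Etale π› ‹_›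
    have hne : ((Proj.basicOpen 𝒜 (X 0 * X 1) : P.Opens) : Set P).Nonempty := by
      rw [← Proj.opensRange_awayι 𝒜 (X 0 * X 1) (SetLike.mul_mem_graded hx0 hx1) two_pos]
      haveI : Nontrivial Λ := (P1Charts.laurentEquiv k).symm.toEquiv.nontrivial
      exact Set.range_nonempty _
    obtain ⟨p, hp⟩ := hne
    obtain ⟨y, hy⟩ := hsurj.surj p
    have hyV : y ∈ V₀ ⊓ V₁ := by
      rw [hV]
      show π.base y ∈ (U₀₁ : Set P)
      have hy' : π.base y = p := hy
      rw [hy']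
      exact hp
    exact (Y.presheaf.germ (V₀ ⊓ V₁) y hyV).hom.domain_nontrivial
  -- idempotents of `B⁺ ∩ B⁻ = Γ(Y, 𝒪)` are trivial (connectedness)
  have ht0 : P1Charts.tgen k ≠ 0 := by
    have := (map_ne_zero_iff _ (P1Charts.polyEquiv k 0).injective).mpr (Polynomial.X_ne_zero (R := k))
    rwa [P1Charts.polyEquiv_X] at this
  have hs0 : P1Charts.sgen k ≠ 0 := by
    have := (map_ne_zero_iff _ (P1Charts.polyEquiv k 1).injective).mpr (Polynomial.X_ne_zero (R := k))
    rwa [P1Charts.polyEquiv_X] at this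
  have hinj₀ : Function.Injective (algebraMap B₀ N) := by
    refine IsLocalization.injective (M := Submonoid.powers (a₀ (P1Charts.tgen k))) N ?_
    rintro _ ⟨n, rfl⟩
    have haux : ∀ b : B₀, a₀ (P1Charts.tgen k) * b = 0 → b = 0 := fun b hb =>
      (smul_eq_zero_iff_right ht0).mp (by rw [Algebra.smul_def]; exact hb)
    exact pow_mem (mem_nonZeroDivisors_iff.mpr
      ⟨fun b hb => haux b hb, fun b hb => haux b (by rwa [mul_comm] at hb)⟩) n
  have hinj₁ : Function.Injective (algebraMap B₁ N) := by
    refine IsLocalization.injective (M := Submonoid.powers (a₁ (P1Charts.sgen k))) N ?_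
    rintro _ ⟨n, rfl⟩
    have haux : ∀ b : B₁, a₁ (P1Charts.sgen k) * b = 0 → b = 0 := fun b hb =>
      (smul_eq_zero_iff_right hs0).mp (by rw [Algebra.smul_def]; exact hb)
    exact pow_mem (mem_nonZeroDivisors_iff.mpr
      ⟨fun b hb => haux b hb, fun b hb => haux b (by rwa [mul_comm] at hb)⟩) n
  have Hidem : ∀ e ∈ coordSub bN₀ (degGE (P1Charts.ℓ k) 0) ⊓ coordSub bN₁ (degLE (P1Charts.ℓ k) 0),
      IsIdempotentElem e → e = 0 ∨ e = 1 := by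
    intro e he hee
    obtain ⟨e₀, he₀⟩ := (hB₀ e).mp he.1
    obtain ⟨e₁, he₁⟩ := (hB₁ e).mp he.2
    have hie₀ : IsIdempotentElem e₀ := hinj₀ (by rw [map_mul, he₀]; exact hee)
    have hie₁ : IsIdempotentElem e₁ := hinj₁ (by rw [map_mul, he₁]; exact hee)
    have hagree : r₀ e₀ = r₁ e₁ := he₀.trans he₁.symm
    rw [← he₀]
    exact restrict_eq_zero_or_one_of_isIdempotentElem hcovY e₀ e₁ hie₀ hie₁ hagree
  -- the `bN₀ i` lie in `B⁻[t] = B₁[1/s]`: a uniform twist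
  have hℓpow : ∀ n : ℕ, P1Charts.ℓ k (-1) ^ n = P1Charts.ℓ k (-(n : ℤ)) := by
    intro n
    induction n with
    | zero => simp [P1Charts.ℓ_zero]
    | succ n ih => rw [pow_succ, ih, P1Charts.ℓ_mul]; congr 1; push_cast; ring
  have Hc0 : ∀ i, ∃ m : ℕ,
      P1Charts.ℓ k (-(m : ℤ)) • bN₀ i ∈ coordSub bN₁ (degLE (P1Charts.ℓ k) 0) := by
    intro i
    obtain ⟨⟨y, _, n, rfl⟩, hy⟩ :=
      IsLocalization.surj (Submonoid.powers (a₁ (P1Charts.sgen k))) (bN₀ i)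
    refine ⟨n, (hB₁ _).mpr ⟨y, ?_⟩⟩
    rw [← hy, Algebra.smul_def, mul_comm]
    congr 1
    rw [map_pow]
    change (r₁ (a₁ (P1Charts.sgen k))) ^ n = aΛ (P1Charts.ℓ k (-(n : ℤ)))
    rw [sq₁, ← P1Charts.ℓ_neg_one, ← map_pow, hℓpow]
  choose m hm using Hc0
  have Hc : ∀ i, P1Charts.ℓ k (1 - ((1 + ∑ j, m j : ℕ) : ℤ)) • bN₀ i ∈
      coordSub bN₁ (degLE (P1Charts.ℓ k) 0) := by
    intro i
    have hle : m i ≤ ∑ j, m j := Finset.single_le_sum (fun j _ => Nat.zero_le (m j)) (Finset.mem_univ i)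
    have hprod : P1Charts.ℓ k (1 - ((1 + ∑ j, m j : ℕ) : ℤ)) =
        P1Charts.ℓ k (-(((∑ j, m j) - m i : ℕ) : ℤ)) * P1Charts.ℓ k (-(m i : ℤ)) := by
      rw [P1Charts.ℓ_mul]; congr 1; push_cast [hle]; ring
    have h2 := LaurentLattice.smul_mem_Bm hℓ
      (self_mem_degLE (P1Charts.ℓ k) (show (-(((∑ j, m j) - m i : ℕ) : ℤ)) ≤ 0 by omega)) (hm i)
    simp only [Algebra.smul_def] at h2 ⊢
    rw [← mul_assoc, ← map_mul, ← hprod] at h2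
    exact h2
  -- **the lattice criterion**: the rank is `≤ 1`
  have hcard₁ : Fintype.card (Module.Free.ChooseBasisIndex A₁ B₁) ≤ 1 :=
    card_le_one_of_idempotent hℓ Hbd Hdual Hdual' Hidem Hmul Hmul' Hone Hone' Hc
  have hcard₀₁ : Fintype.card (Module.Free.ChooseBasisIndex A₀ B₀) =
      Fintype.card (Module.Free.ChooseBasisIndex A₁ B₁) := card_eq_card hℓ bN₀ bN₁
  haveI : Nontrivial B₁ := r₁.domain_nontrivial
  have hcard₁' : Fintype.card (Module.Free.ChooseBasisIndex A₁ B₁) = 1 :=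
    le_antisymm hcard₁ (Fintype.card_pos_iff.mpr b₁.index_nonempty)
  -- hence `A₀ → B₀` and `A₁ → B₁` are bijective
  have hbij₀ : Function.Bijective a₀ :=
    bijective_algebraMap_of_basis_card_eq_one b₀ (hcard₀₁.trans hcard₁')
  have hbij₁ : Function.Bijective a₁ := bijective_algebraMap_of_basis_card_eq_one b₁ hcard₁'
  have hbijapp₀ : Function.Bijective (π.app U₀).hom := by
    let e := (Proj.basicOpenIsoAway 𝒜 (X 0) hx0 one_pos).commRingCatIsoToRingEquiv
    have : ((π.app U₀).hom : Γ(P, U₀) → B₀) = a₀ ∘ e.symm := by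
      funext z
      change _ = (π.app U₀).hom (Proj.awayToSection 𝒜 (X 0) (e.symm z))
      congr 1
      exact (e.apply_symm_apply z).symm
    rw [this]
    exact hbij₀.comp e.symm.bijective
  have hbijapp₁ : Function.Bijective (π.app U₁).hom := by
    let e := (Proj.basicOpenIsoAway 𝒜 (X 1) hx1 one_pos).commRingCatIsoToRingEquiv
    have : ((π.app U₁).hom : Γ(P, U₁) → B₁) = a₁ ∘ e.symm := by
      funext z
      change _ = (π.app U₁).hom (Proj.awayToSection 𝒜 (X 1) (e.symm z))
      congr 1
      exact (e.apply_symm_apply z).symm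
    rw [this]
    exact hbij₁.comp e.symm.bijective
  haveI happ₀ : IsIso (π.app U₀) := isIso_of_bijective_hom _ hbijapp₀
  haveI happ₁ : IsIso (π.app U₁) := isIso_of_bijective_hom _ hbijapp₁
  -- so `π` is an isomorphism over each chart, hence an isomorphism
  let Uc : Fin 2 → P.affineOpens := ![⟨U₀, hU₀⟩, ⟨U₁, hU₁⟩]
  have hUc : ⨆ i, (Uc i : P.Opens) = ⊤ := by
    rw [eq_top_iff, ← hcovP]
    exact sup_le (le_iSup (fun i => (Uc i : P.Opens)) 0) (le_iSup (fun i => (Uc i : P.Opens)) 1)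
  have hchart : ∀ (W : P.affineOpens), IsIso (π.app W) →
      IsAffine (π ⁻¹ᵁ (W : P.Opens)) ∧ IsIso (π ∣_ (W : P.Opens)).appTop := by
    intro W hW
    refine ⟨W.2.preimage π, ?_⟩
    rw [morphismRestrict_appTop]
    haveI h1 : IsIso (π.app ((W : P.Opens).ι ''ᵁ ⊤)) :=
      isIso_app_of_eq π (W : P.Opens).ι_image_top.symm hW
    haveI h2 : IsIso (Y.presheaf.map
        (eqToHom (image_morphismRestrict_preimage π (W : P.Opens) ⊤)).op) :=
      Y.presheaf.map_isIso _
    exact @IsIso.comp_isIso _ _ _ _ _ _ _ h1 h2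
  have := (HasAffineProperty.iff_of_iSup_eq_top (P := MorphismProperty.isomorphisms Scheme)
    (f := π) Uc hUc).mpr (fun i => by
      fin_cases i
      · exact hchart ⟨U₀, hU₀⟩ happ₀
      · exact hchart ⟨U₁, hU₁⟩ happ₁)
  exact (MorphismProperty.isomorphisms.iff _).mp this

/-- **`ProjectiveLineSimplyConnected` by trace duality** (SGA 1, Exp. XI, Prop. 1.1, `r = 1`):
every finite étale `π : Y → ℙ¹_k` with `Y` connected, `k` algebraically closed, is an
isomorphism — a second, independent proof of the named fact (the discharge
`ProjectiveLineSimplyConnected_holds` of `ProjectiveLineSimplyConnectedHolds.lean` follows the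
printed Riemann–Hurwitz route through function fields; this one uses no curve theory).
[cite: SGA1, Exp. XI Prop. 1.1] -/
theorem projectiveLineSimplyConnected_of_traceDuality : ProjectiveLineSimplyConnected.{u} := by
  intro k _ _ Y π hfin het hconn
  exact @isIso_of_isFinite_of_etale_proj_of_traceDuality k _ _ Y π hfin het hconn

end Main

end Literature.AlgebraicGeometry.FundamentalGroup
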